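import Summits.BirchSwinnertonDyer.BirchSwinnertonDyer.Theorems.Rank2ObservatoryReductionWitnessT22
import HarnessLib

/-!
# BirchSwinnertonDyer — rank ≥ 2 observatory: rank-2 kernel certificates, torsion `ℤ/2 × ℤ/4`

HONEST FRAMING: per-curve certified theorems and census instruments; no claim on BSD in rank ≥ 2.

For the census rows with `E(ℚ)[2^∞] ≅ ℤ/2 × ℤ/4` the `2`-exponent of the torsion annihilator is
`u = 2` and the coset test reads `R ∉ 2E(ℚ) + E(ℚ)[4]`. Data: the three rational `2`-torsion points
`T' = (x₁, y₁)`, `T = (x_T, y_T)`, `T₃ = (x₃, y₃)` and `T₄ = (x₄, y₄)` with `2T₄ = T`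
(`intTangent`);
ONE good odd prime `ℓ₁` certifies `E(ℚ)[2] = {O, T', T, T₃}` (`twoTorsionOnly3B`) and `T' + T = T₃`
(chord mod `ℓ₁` + injectivity of reduction on `2`-torsion); good primes at which `T̃'`, `T̃₃`,
`T̃₄`,
`(T₄ + T')~`, `(T₄ + T)~`, `(T₄ + T₃)~` are no doubles give `E(ℚ)[4] ⊆ H := {O, T', T, T₃, T₄,
T₄ + T', T₄ + T, T₄ + T₃}` (`fourTorsion_subset8`) and "no rational point of order `8`", so `4m`
kills `E(ℚ)_tors`. Then `R ∉ 2E(ℚ) + E(ℚ)[4]` follows from `R, R + T', R + T₄, R + T₄ + T' ∉ 2E(ℚ)`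
(`not_mem_twoCoset_two_of_fourTorsion_subset8`), each certified at its own good prime
(`Rank2ObservatoryShiftWitness`; three chords for `P₁ + P₂ + T₄ + T'`: `sumShiftShiftFree`).
Certificate: `two_le_mordellWeilRank_of_kernelCertT24`. Sorry-free.
References: Silverman AEC (2009) III.2.3, VII.3.1(b), VII.3.4, VIII.6.7; Cremona (1997) §3.3, §3.5.
-/

-- single-conjunct summit: `Summit.BirchSwinnertonDyer.BirchSwinnertonDyer.…` repeats the name by design
set_option linter.dupNamespace false

namespace Summit.BirchSwinnertonDyer.BirchSwinnertonDyer.Rank2Observatory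

open WeierstrassCurve Literature.NumberTheory.EllipticCurves

section Abstract

variable {A : Type*} [AddCommGroup A]

/-- If `A[4] ⊆ {0, T', T, T₃, T₄, T₄ + T', T₄ + T, T₄ + T₃}` with `T₄ + T₄ = T`, `T' + T = T₃`, and
none of `x, x + T', x + T₄, x + T₄ + T'` lies in `2A`, then `x ∉ 2A + A[4]`. [folklore] -/
theorem not_mem_twoCoset_two_of_fourTorsion_subset8 {T' T T₃ T₄ x : A}
    (h4 : ∀ τ : A, (2 : ℤ) ^ 2 • τ = 0 → τ = 0 ∨ τ = T' ∨ τ = T ∨ τ = T₃ ∨ τ = T₄ ∨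
      τ = T₄ + T' ∨ τ = T₄ + T ∨ τ = T₄ + T₃)
    (hTT : T₄ + T₄ = T) (hT₃ : T' + T = T₃)
    (hx : x ∉ twoCoset A 0) (hx₁ : x + T' ∉ twoCoset A 0) (hx₂ : x + T₄ ∉ twoCoset A 0)
    (hx₃ : x + T₄ + T' ∉ twoCoset A 0) : x ∉ twoCoset A 2 := by
  rintro ⟨b, c, hc, rfl⟩
  rcases h4 c hc with h | h | h | h | h | h | h | h
  · exact hx ⟨b, 0, by rw [smul_zero], by rw [h, add_zero]⟩
  · exact hx₁ ⟨b + T', 0, by rw [smul_zero], by rw [h, add_zero, smul_add]; abel⟩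
  · exact hx ⟨b + T₄, 0, by rw [smul_zero], by rw [h, ← hTT, add_zero, smul_add]; abel⟩
  · exact hx₁ ⟨b + T₄ + T', 0, by rw [smul_zero], by
      rw [h, ← hT₃, ← hTT, add_zero, smul_add, smul_add]; abel⟩
  · exact hx₂ ⟨b + T₄, 0, by rw [smul_zero], by rw [h, add_zero, smul_add]; abel⟩
  · exact hx₃ ⟨b + T₄ + T', 0, by rw [smul_zero], by rw [h, add_zero, smul_add, smul_add]; abel⟩
  · exact hx₂ ⟨b + T₄ + T₄, 0, by rw [smul_zero], by
      rw [h, ← hTT, add_zero, smul_add, smul_add]; abel⟩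
  · exact hx₃ ⟨b + T₄ + T₄ + T', 0, by rw [smul_zero], by
      rw [h, ← hT₃, ← hTT, add_zero, smul_add, smul_add, smul_add]; abel⟩

/-- Generic descent: if `8 • w = 0 → 4 • w = 0` for all `w`, then `2^(k+2) • z = 0 → 4 • z = 0`.
[folklore] -/
theorem four_nsmul_eq_zero_of_pow_nsmul_eq_zero (h84 : ∀ w : A, 8 • w = 0 → 4 • w = 0) :
    ∀ k : ℕ, ∀ z : A, 2 ^ (k + 2) • z = 0 → 4 • z = 0 := by
  intro k
  induction k with
  | zero => intro z hz; simpa using hz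
  | succ k ih =>
    intro z hz
    apply ih
    have hz8 : 8 • (2 ^ k • z) = 0 := by
      rw [← mul_nsmul', show 8 * 2 ^ k = 2 ^ (k + 1 + 2) by ring]; exact hz
    have h4 := h84 (2 ^ k • z) hz8
    rwa [← mul_nsmul', show 4 * 2 ^ k = 2 ^ (k + 2) by ring] at h4

end Abstract

section Rational

variable (V : WeierstrassCurve ℤ)

open scoped Classical in
/-- **`E(ℚ)[4] ⊆ {O, T', T, T₃, T₄, T₄ + T', T₄ + T, T₄ + T₃}`** for `E(ℚ)[2] = {O, T', T, T₃}`
(`twoTorsionOnly3B` at a good odd `ℓ₁`), `2T₄ = T` (`intTangent`), and `T̃'`, `T̃₃` no doubles at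
good primes `l₁`, `l₃`. [cite: SilvermanAEC2009, Prop. VII.3.1(b)] -/
theorem fourTorsion_subset8 {x₁ y₁ xT yT x₃ y₃ x₄ y₄ : ℤ}
    (hT₁ : y₁ ^ 2 + V.a₁ * x₁ * y₁ + V.a₃ * y₁ = x₁ ^ 3 + V.a₂ * x₁ ^ 2 + V.a₄ * x₁ + V.a₆)
    (hT₁2 : 2 * y₁ + V.a₁ * x₁ + V.a₃ = 0)
    (hT : yT ^ 2 + V.a₁ * xT * yT + V.a₃ * yT = xT ^ 3 + V.a₂ * xT ^ 2 + V.a₄ * xT + V.a₆)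
    (hT2 : 2 * yT + V.a₁ * xT + V.a₃ = 0)
    (hT₃ : y₃ ^ 2 + V.a₁ * x₃ * y₃ + V.a₃ * y₃ = x₃ ^ 3 + V.a₂ * x₃ ^ 2 + V.a₄ * x₃ + V.a₆)
    (hT₃2 : 2 * y₃ + V.a₁ * x₃ + V.a₃ = 0)
    (h₄ : y₄ ^ 2 + V.a₁ * x₄ * y₄ + V.a₃ * y₄ = x₄ ^ 3 + V.a₂ * x₄ ^ 2 + V.a₄ * x₄ + V.a₆)
    (htan : intTangent V x₄ y₄ xT yT = true)
    (ℓ₁ : ℕ) [Fact ℓ₁.Prime] (hℓ₁ : ¬ (ℓ₁ : ℤ) ∣ V.Δ) (hodd : ℓ₁ ≠ 2)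
    (hB : twoTorsionOnly3B V ℓ₁ x₁ y₁ xT yT x₃ y₃ = true)
    (l₁ l₃ : ℕ) [Fact l₁.Prime] [Fact l₃.Prime] (hl₁ : ¬ (l₁ : ℤ) ∣ V.Δ) (hl₃ : ¬ (l₃ : ℤ) ∣ V.Δ)
    (hD₁ : xDoubleFree V l₁ (x₁ : ZMod l₁) = true) (hD₃ : xDoubleFree V l₃ (x₃ : ZMod l₃) = true)
    (τ : (V.map (Int.castRingHom ℚ)).toAffine.Point) (hτ : (2 : ℤ) ^ 2 • τ = 0) :
    τ = 0 ∨
      τ = Affine.Point.some (x₁ : ℚ) (y₁ : ℚ)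
        (nonsingular_rat_of_eq V (Δ_ne_zero_of_not_dvd V hℓ₁) hT₁) ∨
      τ = Affine.Point.some (xT : ℚ) (yT : ℚ)
        (nonsingular_rat_of_eq V (Δ_ne_zero_of_not_dvd V hℓ₁) hT) ∨
      τ = Affine.Point.some (x₃ : ℚ) (y₃ : ℚ)
        (nonsingular_rat_of_eq V (Δ_ne_zero_of_not_dvd V hℓ₁) hT₃) ∨
      τ = Affine.Point.some (x₄ : ℚ) (y₄ : ℚ)
        (nonsingular_rat_of_eq V (Δ_ne_zero_of_not_dvd V hℓ₁) h₄) ∨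
      τ = Affine.Point.some (x₄ : ℚ) (y₄ : ℚ)
          (nonsingular_rat_of_eq V (Δ_ne_zero_of_not_dvd V hℓ₁) h₄) +
        Affine.Point.some (x₁ : ℚ) (y₁ : ℚ)
          (nonsingular_rat_of_eq V (Δ_ne_zero_of_not_dvd V hℓ₁) hT₁) ∨
      τ = Affine.Point.some (x₄ : ℚ) (y₄ : ℚ)
          (nonsingular_rat_of_eq V (Δ_ne_zero_of_not_dvd V hℓ₁) h₄) +
        Affine.Point.some (xT : ℚ) (yT : ℚ)
          (nonsingular_rat_of_eq V (Δ_ne_zero_of_not_dvd V hℓ₁) hT) ∨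
      τ = Affine.Point.some (x₄ : ℚ) (y₄ : ℚ)
          (nonsingular_rat_of_eq V (Δ_ne_zero_of_not_dvd V hℓ₁) h₄) +
        Affine.Point.some (x₃ : ℚ) (y₃ : ℚ)
          (nonsingular_rat_of_eq V (Δ_ne_zero_of_not_dvd V hℓ₁) hT₃) := by
  have hΔ : V.Δ ≠ 0 := Δ_ne_zero_of_not_dvd V hℓ₁
  haveI := isElliptic_rat V hΔ
  have hτ4 : 4 • τ = 0 := by
    have h : ((2 : ℤ) ^ 2) = ((4 : ℕ) : ℤ) := by norm_num
    rw [h, natCast_zsmul] at hτ; exact hτ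
  have h22 : (2 : ℤ) • (2 • τ) = 0 := by
    rw [show (2 : ℤ) = ((2 : ℕ) : ℤ) from rfl, natCast_zsmul, ← mul_nsmul]; exact hτ4
  have h2 := twoTorsion_eq_zero_or_eq3 V hT₁ hT₁2 hT hT2 hT₃ hT₃2 ℓ₁ hℓ₁ hodd hB
  set T₄ : (V.map (Int.castRingHom ℚ)).toAffine.Point :=
    .some (x₄ : ℚ) (y₄ : ℚ) (nonsingular_rat_of_eq V hΔ h₄) with hT₄def
  have hTT : T₄ + T₄ = Affine.Point.some (xT : ℚ) (yT : ℚ) (nonsingular_rat_of_eq V hΔ hT) :=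
    some_add_self_of_intTangent V hΔ h₄ hT htan
  rcases h2 (2 • τ) h22 with h0 | h | h | h
  · have hτ2 : (2 : ℤ) • τ = 0 := by
      rw [show (2 : ℤ) = ((2 : ℕ) : ℤ) from rfl, natCast_zsmul]; exact h0
    rcases h2 τ hτ2 with h0' | h' | h' | h'
    · exact Or.inl h0'
    · exact Or.inr (Or.inl h')
    · exact Or.inr (Or.inr (Or.inl h'))
    · exact Or.inr (Or.inr (Or.inr (Or.inl h')))
  · exact absurd h (two_nsmul_ne_some_of_xDoubleFree V hΔ hT₁ l₁ hl₁ hD₁ τ)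
  · have hd : (2 : ℤ) • (τ - T₄) = 0 := by
      rw [zsmul_sub, two_zsmul, two_zsmul, ← two_nsmul, h, hTT, sub_self]
    rcases h2 (τ - T₄) hd with h0' | h' | h' | h'
    · exact Or.inr (Or.inr (Or.inr (Or.inr (Or.inl (sub_eq_zero.mp h0')))))
    · exact Or.inr (Or.inr (Or.inr (Or.inr (Or.inr (Or.inl (sub_eq_iff_eq_add'.mp h'))))))
    · exact Or.inr (Or.inr (Or.inr (Or.inr (Or.inr (Or.inr (Or.inl (sub_eq_iff_eq_add'.mp h')))))))
    · exact Or.inr (Or.inr (Or.inr (Or.inr (Or.inr (Or.inr (Or.inr (sub_eq_iff_eq_add'.mp h')))))))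
  · exact absurd h (two_nsmul_ne_some_of_xDoubleFree V hΔ hT₃ l₃ hl₃ hD₃ τ)

open scoped Classical in
/-- **No rational point of order `8`** for `E(ℚ)[4] ⊆ {O, T', T, T₃, T₄, T₄ + T', T₄ + T, T₄ + T₃}`:
`8 • w = 0 → 4 • w = 0`, given good primes at which `T̃'`, `T̃₃`, `T̃₄` and (by chords)
`(T₄ + T')~`, `(T₄ + T)~`, `(T₄ + T₃)~` are no doubles.
[cite: SilvermanAEC2009, Prop. VII.3.1(b)] -/
theorem four_nsmul_eq_zero_of_z24Witness {x₁ y₁ xT yT x₃ y₃ x₄ y₄ : ℤ}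
    (hT₁ : y₁ ^ 2 + V.a₁ * x₁ * y₁ + V.a₃ * y₁ = x₁ ^ 3 + V.a₂ * x₁ ^ 2 + V.a₄ * x₁ + V.a₆)
    (hT₁2 : 2 * y₁ + V.a₁ * x₁ + V.a₃ = 0)
    (hT : yT ^ 2 + V.a₁ * xT * yT + V.a₃ * yT = xT ^ 3 + V.a₂ * xT ^ 2 + V.a₄ * xT + V.a₆)
    (hT2 : 2 * yT + V.a₁ * xT + V.a₃ = 0)
    (hT₃ : y₃ ^ 2 + V.a₁ * x₃ * y₃ + V.a₃ * y₃ = x₃ ^ 3 + V.a₂ * x₃ ^ 2 + V.a₄ * x₃ + V.a₆)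
    (hT₃2 : 2 * y₃ + V.a₁ * x₃ + V.a₃ = 0)
    (h₄ : y₄ ^ 2 + V.a₁ * x₄ * y₄ + V.a₃ * y₄ = x₄ ^ 3 + V.a₂ * x₄ ^ 2 + V.a₄ * x₄ + V.a₆)
    (htan : intTangent V x₄ y₄ xT yT = true)
    (ℓ₁ : ℕ) [Fact ℓ₁.Prime] (hℓ₁ : ¬ (ℓ₁ : ℤ) ∣ V.Δ) (hodd : ℓ₁ ≠ 2)
    (hB : twoTorsionOnly3B V ℓ₁ x₁ y₁ xT yT x₃ y₃ = true)
    (l₁ l₃ l₄ : ℕ) [Fact l₁.Prime] [Fact l₃.Prime] [Fact l₄.Prime]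
    (hl₁ : ¬ (l₁ : ℤ) ∣ V.Δ) (hl₃ : ¬ (l₃ : ℤ) ∣ V.Δ) (hl₄ : ¬ (l₄ : ℤ) ∣ V.Δ)
    (hD₁ : xDoubleFree V l₁ (x₁ : ZMod l₁) = true) (hD₃ : xDoubleFree V l₃ (x₃ : ZMod l₃) = true)
    (hD₄ : xDoubleFree V l₄ (x₄ : ZMod l₄) = true)
    (l₅ l₆ l₇ : ℕ) [Fact l₅.Prime] [Fact l₆.Prime] [Fact l₇.Prime]
    (hl₅ : ¬ (l₅ : ℤ) ∣ V.Δ) (hl₆ : ¬ (l₆ : ℤ) ∣ V.Δ) (hl₇ : ¬ (l₇ : ℤ) ∣ V.Δ)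
    {A₅ B₅ : ℤ} (hD₅ : shiftFree V l₅ x₄ y₄ x₁ y₁ A₅ B₅ = true)
    {A₆ B₆ : ℤ} (hD₆ : shiftFree V l₆ x₄ y₄ xT yT A₆ B₆ = true)
    {A₇ B₇ : ℤ} (hD₇ : shiftFree V l₇ x₄ y₄ x₃ y₃ A₇ B₇ = true)
    (w : (V.map (Int.castRingHom ℚ)).toAffine.Point) (h : 8 • w = 0) : 4 • w = 0 := by
  have hΔ : V.Δ ≠ 0 := Δ_ne_zero_of_not_dvd V hℓ₁
  haveI := isElliptic_rat V hΔ
  have h44 : 4 • w = 2 • (2 • w) := by rw [← mul_nsmul]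
  have hτ : (2 : ℤ) ^ 2 • (2 • w) = 0 := by
    have e : ((2 : ℤ) ^ 2) = ((4 : ℕ) : ℤ) := by norm_num
    rw [e, natCast_zsmul, ← mul_nsmul]; exact h
  rcases fourTorsion_subset8 V hT₁ hT₁2 hT hT2 hT₃ hT₃2 h₄ htan ℓ₁ hℓ₁ hodd hB l₁ l₃ hl₁ hl₃ hD₁ hD₃
    (2 • w) hτ with h0 | h' | h' | h' | h' | h' | h' | h'
  · rw [h44, h0, nsmul_zero]
  · exact absurd h' (two_nsmul_ne_some_of_xDoubleFree V hΔ hT₁ l₁ hl₁ hD₁ w)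
  · rw [h44, h']; exact two_nsmul_some_eq_zero V hΔ hT hT2
  · exact absurd h' (two_nsmul_ne_some_of_xDoubleFree V hΔ hT₃ l₃ hl₃ hD₃ w)
  · exact absurd h' (two_nsmul_ne_some_of_xDoubleFree V hΔ h₄ l₄ hl₄ hD₄ w)
  · exact absurd h' (two_nsmul_ne_add_of_shiftFree V hΔ l₅ hl₅ h₄ hT₁ hD₅ w)
  · exact absurd h' (two_nsmul_ne_add_of_shiftFree V hΔ l₆ hl₆ h₄ hT hD₆ w)
  · exact absurd h' (two_nsmul_ne_add_of_shiftFree V hΔ l₇ hl₇ h₄ hT₃ hD₇ w)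

/-- **`4m` kills `E(ℚ)_tors`** when `t = 2^e·m` does (`annihilatorCheck`) and `E(ℚ)` has no point of
order `8` (hypothesis `h84`). [cite: SilvermanAEC2009, Prop. VII.3.1(b), Thm. VII.3.4] -/
theorem torsion_zsmul_eq_zero_of_noOrderEight {S : List (ℕ × ℕ)} {t e m : ℕ} (hte : t = 2 ^ e * m)
    (hS : ∀ ℓN ∈ S, ℓN.1.Prime ∧
      ∀ (x : (V.map (Int.castRingHom ℚ)).toAffine.Point) (n : ℕ), ¬ ℓN.1 ∣ n → n • x = 0 →
        ℓN.2 • x = 0)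
    (ht : annihilatorCheck S t = true)
    (h84 : ∀ w : (V.map (Int.castRingHom ℚ)).toAffine.Point, 8 • w = 0 → 4 • w = 0)
    (x : (V.map (Int.castRingHom ℚ)).toAffine.Point) (hx : IsOfFinAddOrder x) :
    ((2 : ℤ) ^ 2 * (m : ℤ)) • x = 0 := by
  have htx : t • x = 0 := nsmul_eq_zero_of_annihilatorCheck hS ht hx
  rw [hte, mul_nsmul'] at htx
  rw [show ((2 : ℤ) ^ 2 * (m : ℤ)) = ((4 * m : ℕ) : ℤ) by push_cast; ring, natCast_zsmul,
    mul_nsmul']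
  match e, htx with
  | 0, htx => rw [pow_zero, one_nsmul] at htx; rw [htx, nsmul_zero]
  | 1, htx =>
      rw [pow_one] at htx
      rw [show (4 : ℕ) = 2 * 2 from rfl, mul_nsmul, htx, nsmul_zero]
  | k + 2, htx => exact four_nsmul_eq_zero_of_pow_nsmul_eq_zero h84 k _ htx

/-- Boolean: `(X₃, Y₃) ≡ P₁ + P₂`, then `sumShiftFree` for `(X₃, Y₃) + (x₄, y₄)` shifted by
`(x_T, y_T)` (three chords mod `q`, the last sum the abscissa of no double).
[cite: CremonaAlgorithms1997, §3.5] -/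
def sumShiftShiftFree (V : WeierstrassCurve ℤ) (q : ℕ) [NeZero q]
    (X₁ Y₁ X₂ Y₂ X₃ Y₃ x₄ y₄ X₄ Y₄ xT yT A B : ℤ) : Bool :=
  zmodChord V q (X₁ : ZMod q) (Y₁ : ZMod q) (X₂ : ZMod q) (Y₂ : ZMod q) (X₃ : ZMod q) (Y₃ : ZMod q)
    && sumShiftFree V q X₃ Y₃ x₄ y₄ X₄ Y₄ xT yT A B

open scoped Classical in
/-- Soundness of `sumShiftShiftFree`: `P₁ + P₂ + T₄ + T ∉ 2E(ℚ)` for integral points.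
[cite: SilvermanAEC2009, Prop. VII.3.1(b)] -/
theorem not_mem_twoCoset_zero_of_sumShiftShiftFree (q : ℕ) [Fact q.Prime] (hq : ¬ (q : ℤ) ∣ V.Δ)
    {X₁ Y₁ X₂ Y₂ X₃ Y₃ x₄ y₄ X₄ Y₄ xT yT A B : ℤ}
    (h₁ : Y₁ ^ 2 + V.a₁ * X₁ * Y₁ + V.a₃ * Y₁ = X₁ ^ 3 + V.a₂ * X₁ ^ 2 + V.a₄ * X₁ + V.a₆)
    (h₂ : Y₂ ^ 2 + V.a₁ * X₂ * Y₂ + V.a₃ * Y₂ = X₂ ^ 3 + V.a₂ * X₂ ^ 2 + V.a₄ * X₂ + V.a₆)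
    (h₄ : y₄ ^ 2 + V.a₁ * x₄ * y₄ + V.a₃ * y₄ = x₄ ^ 3 + V.a₂ * x₄ ^ 2 + V.a₄ * x₄ + V.a₆)
    (hT : yT ^ 2 + V.a₁ * xT * yT + V.a₃ * yT = xT ^ 3 + V.a₂ * xT ^ 2 + V.a₄ * xT + V.a₆)
    (hw : sumShiftShiftFree V q X₁ Y₁ X₂ Y₂ X₃ Y₃ x₄ y₄ X₄ Y₄ xT yT A B = true) :
    (Affine.Point.some (X₁ : ℚ) (Y₁ : ℚ) (nonsingular_rat_of_eq V (Δ_ne_zero_of_not_dvd V hq) h₁) +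
        Affine.Point.some (X₂ : ℚ) (Y₂ : ℚ)
          (nonsingular_rat_of_eq V (Δ_ne_zero_of_not_dvd V hq) h₂) +
        Affine.Point.some (x₄ : ℚ) (y₄ : ℚ)
          (nonsingular_rat_of_eq V (Δ_ne_zero_of_not_dvd V hq) h₄) +
        Affine.Point.some (xT : ℚ) (yT : ℚ)
          (nonsingular_rat_of_eq V (Δ_ne_zero_of_not_dvd V hq) hT) :
        (V.map (Int.castRingHom ℚ)).toAffine.Point) ∉
      twoCoset (V.map (Int.castRingHom ℚ)).toAffine.Point 0 := by
  simp only [sumShiftShiftFree, sumShiftFree, shiftFree, Bool.and_eq_true] at hw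
  obtain ⟨hc, hc', hc'', hfree⟩ := hw
  have e₁ : V.toAffine.Equation X₁ Y₁ := (Affine.equation_iff X₁ Y₁).mpr h₁
  have e₂ : V.toAffine.Equation X₂ Y₂ := (Affine.equation_iff X₂ Y₂).mpr h₂
  have e₄ : V.toAffine.Equation x₄ y₄ := (Affine.equation_iff x₄ y₄).mpr h₄
  have eT : V.toAffine.Equation xT yT := (Affine.equation_iff xT yT).mpr hT
  apply not_mem_twoCoset_of_map_not_mem (reduceMod V q hq)
  obtain ⟨h₃, e₃⟩ := exists_some_add_some_of_zmodChord V q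
    (nonsingular_zmod_of_equation V q hq e₁) (nonsingular_zmod_of_equation V q hq e₂) hc
  obtain ⟨h₅, e₅⟩ := exists_some_add_some_of_zmodChord V q h₃
    (nonsingular_zmod_of_equation V q hq e₄) hc'
  obtain ⟨h₆, e₆⟩ := exists_some_add_some_of_zmodChord V q h₅
    (nonsingular_zmod_of_equation V q hq eT) hc''
  rw [map_add, map_add, map_add, reduceMod_some V q hq e₁, reduceMod_some V q hq e₂, e₃,
    reduceMod_some V q hq e₄, e₅, reduceMod_some V q hq eT, e₆]
  exact not_mem_twoCoset_of_xDoubleFree V q hfree h₆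

end Rational

/-! ### The rank-2 certificate for `E(ℚ)[2^∞] ≅ ℤ/2 × ℤ/4` -/

section Assembly

variable (V : WeierstrassCurve ℤ)

/-- **Rank-2 kernel certificate for `E(ℚ)[2^∞] ≅ ℤ/2 × ℤ/4`**: integral `P₁, P₂`; annihilator
`t = 2^e·m` from kernel point counts; the rational `2`-torsion points `T' = (x₁, y₁)`,
`T = (x_T, y_T)`,
`T₃ = (x₃, y₃)` and `T₄ = (x₄, y₄)` with `2T₄ = T` (`intTangent`); one good odd prime `ℓ₁` with
`twoTorsionOnly3B` and the chord `T' + T ≡ T₃`; good primes at which `T̃'`, `T̃₃`, `T̃₄`,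
`(T₄ + T')~`, `(T₄ + T)~`, `(T₄ + T₃)~` are no doubles (so `E(ℚ)[4] ⊆ ⟨T', T₄⟩` and no rational
point of order `8`: `4m` kills `E(ℚ)_tors`, `u = 2`); and for each `R ∈ {P₁, P₂, P₁ + P₂}` four good
primes certifying `R, R + T', R + T₄, R + T₄ + T' ∉ 2E(ℚ)` one at a time (chords mod the prime).
Then `2 ≤ rank_ℤ E(ℚ)`.
[cite: CremonaAlgorithms1997, §3.5] [cite: SilvermanAEC2009, Thm. VIII.6.7] -/
theorem two_le_mordellWeilRank_of_kernelCertT24 {X₁ Y₁ X₂ Y₂ : ℤ}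
    (h₁ : Y₁ ^ 2 + V.a₁ * X₁ * Y₁ + V.a₃ * Y₁ = X₁ ^ 3 + V.a₂ * X₁ ^ 2 + V.a₄ * X₁ + V.a₆)
    (h₂ : Y₂ ^ 2 + V.a₁ * X₂ * Y₂ + V.a₃ * Y₂ = X₂ ^ 3 + V.a₂ * X₂ ^ 2 + V.a₄ * X₂ + V.a₆)
    {S : List (ℕ × ℕ)} {t e m : ℕ} (hm : m % 2 = 1) (hte : t = 2 ^ e * m)
    (hS : ∀ ℓN ∈ S, ℓN.1.Prime ∧
      ∀ (x : (V.map (Int.castRingHom ℚ)).toAffine.Point) (n : ℕ), ¬ ℓN.1 ∣ n → n • x = 0 →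
        ℓN.2 • x = 0)
    (ht : annihilatorCheck S t = true)
    {x₁ y₁ xT yT x₃ y₃ x₄ y₄ : ℤ}
    (hT₁ : y₁ ^ 2 + V.a₁ * x₁ * y₁ + V.a₃ * y₁ = x₁ ^ 3 + V.a₂ * x₁ ^ 2 + V.a₄ * x₁ + V.a₆)
    (hT₁2 : 2 * y₁ + V.a₁ * x₁ + V.a₃ = 0)
    (hT : yT ^ 2 + V.a₁ * xT * yT + V.a₃ * yT = xT ^ 3 + V.a₂ * xT ^ 2 + V.a₄ * xT + V.a₆)
    (hT2 : 2 * yT + V.a₁ * xT + V.a₃ = 0)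
    (hT₃ : y₃ ^ 2 + V.a₁ * x₃ * y₃ + V.a₃ * y₃ = x₃ ^ 3 + V.a₂ * x₃ ^ 2 + V.a₄ * x₃ + V.a₆)
    (hT₃2 : 2 * y₃ + V.a₁ * x₃ + V.a₃ = 0)
    (h₄ : y₄ ^ 2 + V.a₁ * x₄ * y₄ + V.a₃ * y₄ = x₄ ^ 3 + V.a₂ * x₄ ^ 2 + V.a₄ * x₄ + V.a₆)
    (htan : intTangent V x₄ y₄ xT yT = true)
    (ℓ₁ : ℕ) [Fact ℓ₁.Prime] (hℓ₁ : ¬ (ℓ₁ : ℤ) ∣ V.Δ) (hodd : ℓ₁ ≠ 2)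
    (hB : twoTorsionOnly3B V ℓ₁ x₁ y₁ xT yT x₃ y₃ = true)
    (hc₃ : zmodChord V ℓ₁ (x₁ : ZMod ℓ₁) (y₁ : ZMod ℓ₁) (xT : ZMod ℓ₁) (yT : ZMod ℓ₁) (x₃ : ZMod ℓ₁)
      (y₃ : ZMod ℓ₁) = true)
    (l₁ l₃ l₄ : ℕ) [Fact l₁.Prime] [Fact l₃.Prime] [Fact l₄.Prime]
    (hl₁ : ¬ (l₁ : ℤ) ∣ V.Δ) (hl₃ : ¬ (l₃ : ℤ) ∣ V.Δ) (hl₄ : ¬ (l₄ : ℤ) ∣ V.Δ)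
    (hD₁ : xDoubleFree V l₁ (x₁ : ZMod l₁) = true) (hD₃ : xDoubleFree V l₃ (x₃ : ZMod l₃) = true)
    (hD₄ : xDoubleFree V l₄ (x₄ : ZMod l₄) = true)
    (l₅ l₆ l₇ : ℕ) [Fact l₅.Prime] [Fact l₆.Prime] [Fact l₇.Prime]
    (hl₅ : ¬ (l₅ : ℤ) ∣ V.Δ) (hl₆ : ¬ (l₆ : ℤ) ∣ V.Δ) (hl₇ : ¬ (l₇ : ℤ) ∣ V.Δ)
    {A₅ B₅ : ℤ} (hD₅ : shiftFree V l₅ x₄ y₄ x₁ y₁ A₅ B₅ = true)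
    {A₆ B₆ : ℤ} (hD₆ : shiftFree V l₆ x₄ y₄ xT yT A₆ B₆ = true)
    {A₇ B₇ : ℤ} (hD₇ : shiftFree V l₇ x₄ y₄ x₃ y₃ A₇ B₇ = true)
    (q₁₀ q₁₁ q₁₂ q₁₃ : ℕ) [Fact q₁₀.Prime] [Fact q₁₁.Prime] [Fact q₁₂.Prime] [Fact q₁₃.Prime]
    (hq₁₀ : ¬ (q₁₀ : ℤ) ∣ V.Δ) (hq₁₁ : ¬ (q₁₁ : ℤ) ∣ V.Δ) (hq₁₂ : ¬ (q₁₂ : ℤ) ∣ V.Δ)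
    (hq₁₃ : ¬ (q₁₃ : ℤ) ∣ V.Δ)
    (hw₁₀ : xDoubleFree V q₁₀ (X₁ : ZMod q₁₀) = true)
    {A₁₁ B₁₁ : ℤ} (hw₁₁ : shiftFree V q₁₁ X₁ Y₁ x₁ y₁ A₁₁ B₁₁ = true)
    {A₁₂ B₁₂ : ℤ} (hw₁₂ : shiftFree V q₁₂ X₁ Y₁ x₄ y₄ A₁₂ B₁₂ = true)
    {C₁₃ D₁₃ A₁₃ B₁₃ : ℤ} (hw₁₃ : sumShiftFree V q₁₃ X₁ Y₁ x₄ y₄ C₁₃ D₁₃ x₁ y₁ A₁₃ B₁₃ = true)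
    (q₂₀ q₂₁ q₂₂ q₂₃ : ℕ) [Fact q₂₀.Prime] [Fact q₂₁.Prime] [Fact q₂₂.Prime] [Fact q₂₃.Prime]
    (hq₂₀ : ¬ (q₂₀ : ℤ) ∣ V.Δ) (hq₂₁ : ¬ (q₂₁ : ℤ) ∣ V.Δ) (hq₂₂ : ¬ (q₂₂ : ℤ) ∣ V.Δ)
    (hq₂₃ : ¬ (q₂₃ : ℤ) ∣ V.Δ)
    (hw₂₀ : xDoubleFree V q₂₀ (X₂ : ZMod q₂₀) = true)
    {A₂₁ B₂₁ : ℤ} (hw₂₁ : shiftFree V q₂₁ X₂ Y₂ x₁ y₁ A₂₁ B₂₁ = true)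
    {A₂₂ B₂₂ : ℤ} (hw₂₂ : shiftFree V q₂₂ X₂ Y₂ x₄ y₄ A₂₂ B₂₂ = true)
    {C₂₃ D₂₃ A₂₃ B₂₃ : ℤ} (hw₂₃ : sumShiftFree V q₂₃ X₂ Y₂ x₄ y₄ C₂₃ D₂₃ x₁ y₁ A₂₃ B₂₃ = true)
    (q₃₀ q₃₁ q₃₂ q₃₃ : ℕ) [Fact q₃₀.Prime] [Fact q₃₁.Prime] [Fact q₃₂.Prime] [Fact q₃₃.Prime]
    (hq₃₀ : ¬ (q₃₀ : ℤ) ∣ V.Δ) (hq₃₁ : ¬ (q₃₁ : ℤ) ∣ V.Δ) (hq₃₂ : ¬ (q₃₂ : ℤ) ∣ V.Δ)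
    (hq₃₃ : ¬ (q₃₃ : ℤ) ∣ V.Δ)
    {X₃₀ Y₃₀ : ℤ} (hw₃₀ : sumFree V q₃₀ X₁ Y₁ X₂ Y₂ X₃₀ Y₃₀ = true)
    {X₃₁ Y₃₁ A₃₁ B₃₁ : ℤ} (hw₃₁ : sumShiftFree V q₃₁ X₁ Y₁ X₂ Y₂ X₃₁ Y₃₁ x₁ y₁ A₃₁ B₃₁ = true)
    {X₃₂ Y₃₂ A₃₂ B₃₂ : ℤ} (hw₃₂ : sumShiftFree V q₃₂ X₁ Y₁ X₂ Y₂ X₃₂ Y₃₂ x₄ y₄ A₃₂ B₃₂ = true)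
    {X₃₃ Y₃₃ C₃₃ D₃₃ A₃₃ B₃₃ : ℤ}
    (hw₃₃ : sumShiftShiftFree V q₃₃ X₁ Y₁ X₂ Y₂ X₃₃ Y₃₃ x₄ y₄ C₃₃ D₃₃ x₁ y₁ A₃₃ B₃₃ = true) :
    2 ≤ (V.map (Int.castRingHom ℚ)).mordellWeilRank := by
  classical
  have hΔ : V.Δ ≠ 0 := Δ_ne_zero_of_not_dvd V hℓ₁
  haveI := isElliptic_rat V hΔ
  have hm' : Odd (m : ℤ) := by exact_mod_cast Nat.odd_iff.mpr hm
  have h84 := four_nsmul_eq_zero_of_z24Witness V hT₁ hT₁2 hT hT2 hT₃ hT₃2 h₄ htan ℓ₁ hℓ₁ hodd hB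
    l₁ l₃ l₄ hl₁ hl₃ hl₄ hD₁ hD₃ hD₄ l₅ l₆ l₇ hl₅ hl₆ hl₇ hD₅ hD₆ hD₇
  have htors : ∀ x : (V.map (Int.castRingHom ℚ)).toAffine.Point, IsOfFinAddOrder x →
      ((2 : ℤ) ^ 2 * (m : ℤ)) • x = 0 :=
    fun x hx => torsion_zsmul_eq_zero_of_noOrderEight V hte hS ht h84 x hx
  have h4 := fourTorsion_subset8 V hT₁ hT₁2 hT hT2 hT₃ hT₃2 h₄ htan ℓ₁ hℓ₁ hodd hB l₁ l₃ hl₁ hl₃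
    hD₁ hD₃
  have hTT := some_add_self_of_intTangent V hΔ h₄ hT htan
  have hT₃' := add_eq_of_zmodChord_twoTorsion V ℓ₁ hℓ₁ hodd hT₁ hT₁2 hT hT2 hT₃ hT₃2 hc₃
  refine two_le_mordellWeilRank_of_cosetWitness (V.map (Int.castRingHom ℚ)) hm' htors
    (P₁ := .some _ _ (nonsingular_rat_of_eq V hΔ h₁))
    (P₂ := .some _ _ (nonsingular_rat_of_eq V hΔ h₂))
    (AddMonoidHom.id _) (AddMonoidHom.id _) (AddMonoidHom.id _) ?_ ?_ ?_
  · exact not_mem_twoCoset_two_of_fourTorsion_subset8 h4 hTT hT₃'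
      (not_mem_twoCoset_zero_of_ptFree V q₁₀ hq₁₀ h₁ hw₁₀)
      (not_mem_twoCoset_zero_of_shiftFree V q₁₁ hq₁₁ h₁ hT₁ hw₁₁)
      (not_mem_twoCoset_zero_of_shiftFree V q₁₂ hq₁₂ h₁ h₄ hw₁₂)
      (not_mem_twoCoset_zero_of_sumShiftFree V q₁₃ hq₁₃ h₁ h₄ hT₁ hw₁₃)
  · exact not_mem_twoCoset_two_of_fourTorsion_subset8 h4 hTT hT₃'
      (not_mem_twoCoset_zero_of_ptFree V q₂₀ hq₂₀ h₂ hw₂₀)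
      (not_mem_twoCoset_zero_of_shiftFree V q₂₁ hq₂₁ h₂ hT₁ hw₂₁)
      (not_mem_twoCoset_zero_of_shiftFree V q₂₂ hq₂₂ h₂ h₄ hw₂₂)
      (not_mem_twoCoset_zero_of_sumShiftFree V q₂₃ hq₂₃ h₂ h₄ hT₁ hw₂₃)
  · exact not_mem_twoCoset_two_of_fourTorsion_subset8 h4 hTT hT₃'
      (not_mem_twoCoset_zero_of_sumFree V q₃₀ hq₃₀ h₁ h₂ hw₃₀)
      (not_mem_twoCoset_zero_of_sumShiftFree V q₃₁ hq₃₁ h₁ h₂ hT₁ hw₃₁)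
      (not_mem_twoCoset_zero_of_sumShiftFree V q₃₂ hq₃₂ h₁ h₂ h₄ hw₃₂)
      (not_mem_twoCoset_zero_of_sumShiftShiftFree V q₃₃ hq₃₃ h₁ h₂ h₄ hT₁ hw₃₃)

end Assembly

end Summit.BirchSwinnertonDyer.BirchSwinnertonDyer.Rank2Observatory
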